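import Summits.ABC.IUTFork.Cor312RegimeExactM
import Summits.ABC.IUTFork.Cor312PilotIdelesMNumbersSummand
import Summits.ABC.IUTFork.Cor312ThetaSideGenuineM
import HarnessLib

/-!
# [IUTchIII] Cor. 3.12 at the M-LEVEL genuine setting OF A COLLECTION OF INITIAL Θ-DATA (its own ideles): the typed
# Statement — the [C312] hypothesis `hst` of the downstream certificate, per datum — reduced to the local Θ-terms at the
# bad rational places and ONE datum-independent number

PROOF-ONLY support piece of the abc-iut cell (Cor. 3.12 cone, D-0067; seat abc-iut-w4-d107, gen 5; part 17 of the
`Cor312NegLogThetaUpperPrVol*` / `Cor312RegimeVerbatimPrVol*` chain, sequel of part 16 `Cor312RegimeExactM`). TAKES NO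
SIDE on [IUTchIII] Cor. 3.12; theorems only, 0 `def`s, no new `Prop` fact, no instance.

The C branch's downstream certificate of record `Conditional.abc_of_cor312Statement_genuineM` (abc-iut-C-cert-3, p443000)
reads `ABC` from [C312] `hst` — the typed `Cor312.Setting.Statement` at abc-iut-s2-p8's summand-route M-level sharp setting
`settingPrVolSharpM T.D … (tOfIdeleData T.D r) (tqM … r)` of EVERY admissible datum with its OWN pilot ideles
`r = ideleDataOf T.D T.isVolumeInputOf` — plus the CONE residue. abc-iut-C-cert-2 (12:28Z): «hst is implied by (refuted)
S_H ∧ q-pin but is NOT itself refuted by depth». THIS FILE is the exact per-datum READOUT of that hypothesis from part 16: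

* **`statement_settingPrVolSharpM_genuine_iff`** — for a collection of initial Θ-data `D`, idele data `r` of `D`, any finite
  set `S_Θ` of rational places off which the Θ-ideles of `r` are units and any unit set `S_q` of the `q`-ideles:
  `Statement(D, r) ⟺ ↑(−|log(q)|(D) − PN_i Σ_{u∈S_Θ} (−|log(Θ)|_{i+1,u}(t_q, t) − −|log(Θ)|_{i+1,u}(𝟙))) ≤ −|log(Θ)|(𝟙)`,
  with `−|log(q)|(D) = −(1/2l)·log(q)` the datum's OWN number (abc-iut-w5-d246 / c312-8
  `negLogQ_settingPrVolSharpM_tqM_eq_neg_absLogq`) and `𝟙` the trivial configuration at the same context;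
* `statement_settingPrVolSharpM_genuine_iff_of_image` — the same with `S_Θ` any finite set of rational places containing
  those whose residue characteristic is the residue characteristic of a bad place of the pilot data of `D`
  (abc-iut-w5-d033 / `Cor312ThetaSideGenuineM.norm_tOfIdeleData_eq_one_of_not_mem`).
So, per admissible datum, `hst` says exactly: `(1/2l)·log(q) ≥ PN_i Σ_{bad u} (−|log(Θ)|_{i+1,u}(𝟙) − −|log(Θ)|_{i+1,u}(t)) − −|log(Θ)|(𝟙)`
— the `q`-depth against the Θ-deficit of the datum's boxes at the bad packets relative to the unit boxes, minus the hull
inflation of the unit configuration (every ramified/dyadic packet of `K_{v̲}`). Deciding it requires the hull volumes at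
tamely ramified packets (abc-iut-c312-5's programme); nothing about their size is claimed here.
HONEST SCOPE: bookkeeping about OUR typed objects ((Ind2) as typed; sharp (Ind3) reading; trivial archimedean container);
nothing here asserts or denies [IUTchIII] Cor. 3.12 for initial Θ-data; typed ≠ proved; instantiated ≠ endorsed.
[claim: Mochizuki2012, status: disputed] [cite: Mochizuki2012, IUTchIV Thm. 1.10 p. 23] [cite: DupuyHilado2025, §3.3, §3.9, §4.9, §4.10]
-/

noncomputable section

open Set Function NumberField IsDedekindDomain
open scoped Pointwise

namespace Summit.ABC.IUTFork.Thm311.Real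

open Cor312 Cor312.Setting Cor312Vol Cor312Prov Literature.IUT.LogThetaLattice Literature.IUT.LogVolume
  Literature.IUT.HodgeTheaters Literature.NumberTheory.NumberFields

variable {F K Fbar : Type} [Field F] [NumberField F] [Field K] [NumberField K] [Algebra F K]
  [Field Fbar] [Algebra F Fbar] [Algebra K Fbar] {E : WeierstrassCurve F} [E.IsElliptic] {l : ℕ}
  {Pb : BadPlacePredicates K} (D : InitialThetaData F K Fbar E l Pb) {logvK : PadicLogsVal K}
  (hlog : LogvAnalyticVal logvK)

variable (M : Type) [Field M] [NumberField M]
  (archPk : ∀ (j : (thetaIndexOfInitial D).Label) (vQ : (thetaIndexOfInitial D).VQ),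
    Set ((logShellsOfInitialDH D logvK).Packet j vQ))
  (archSub : ∀ (j : (thetaIndexOfInitial D).Label) (v : (thetaIndexOfInitial D).V),
    Set ((logShellsOfInitialDH D logvK).Packet j ((thetaIndexOfInitial D).over v)))
  (Ψ : ℤ → ∀ v : (thetaIndexOfInitial D).V, v ∈ (thetaIndexOfInitial D).Vbad →
    Set ((logShellsOfInitialDH D logvK).StarPacket v))
  (act : ℤ → ∀ v : (thetaIndexOfInitial D).V, v ∈ (thetaIndexOfInitial D).Vbad →
    (logShellsOfInitialDH D logvK).StarPacket v → Module.End ℚ ((logShellsOfInitialDH D logvK).StarPacket v))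
  (Mmod : ℤ → ∀ j : (thetaIndexOfInitial D).LabelStar, Set ((logShellsOfInitialDH D logvK).GlobalPacket j.1))
  (region : ℤ → ∀ j : (thetaIndexOfInitial D).LabelStar, FinDivisor M → ∀ vQ : (thetaIndexOfInitial D).VQ,
    Set ((logShellsOfInitialDH D logvK).Packet j.1 vQ))
  (n : ℤ) {HT : Type} {LogLink : HT → HT → Type} {IsFull : ∀ {s t : HT}, LogLink s t → Prop}
  (lat : LGPGaussianLogThetaLattice LogLink IsFull)
  {Frd : Type} {IsoF : Frd → Frd → Type} {Ob : Frd → Type} {realify : Frd → Frd} {Strip : Type}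
  {IsoS : Strip → Strip → Type} {Mv : ∀ v : (thetaIndexOfInitial D).V, v ∈ (thetaIndexOfInitial D).Vbad → Type}
  [∀ v h, Monoid (Mv v h)]
  (sig : GlobalLGPFrobenioidSignature (thetaIndexOfInitial D).lstar (thetaIndexOfInitial D).V
    (· ∈ (thetaIndexOfInitial D).Vbad) Frd IsoF Ob realify Strip IsoS Mv)
  (split : SplittingMonoids Mv) {ObΔ : Type} {N : ∀ v : (thetaIndexOfInitial D).V, v ∈ (thetaIndexOfInitial D).Vbad → Type}
  [∀ v h, Monoid (N v h)] (qData : QPilotData ObΔ N)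
  (r : ThetaData.IdeleData D)

/-- **THE TYPED COR. 3.12 AT THE M-LEVEL GENUINE SETTING OF `D` WITH ITS OWN IDELES, READ OUT.** For idele data `r` of
`D` (Θ-ideles `tOfIdeleData D r`, `q`-ideles `tqM … r`), any finite set `S_Θ` of rational places off which the Θ-ideles are
units, and any unit set `S_q` of the `q`-ideles:
`Statement ⟺ ↑(−(1/2l)·log(q) − PN_i Σ_{u∈S_Θ} (−|log(Θ)|_{i+1,u}(t_q, t) − −|log(Θ)|_{i+1,u}(𝟙))) ≤ −|log(Θ)|(𝟙)` — the
`q`-side is the datum's own number `−absLogq D` (abc-iut-c312-8), the Θ-side is localised at the bad rational places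
against the trivial configuration (part 16). No side taken; nothing claimed about the sizes.
[cite: Mochizuki2012, IUTchIV Thm. 1.10 p. 23] [cite: DupuyHilado2025, §3.9, §4.9] [claim: Mochizuki2012, status: disputed] -/
theorem statement_settingPrVolSharpM_genuine_iff (Sθ : Finset (FinitePlace ℚ))
    (hSθ : ∀ (u : FinitePlace ℚ) (i : Fin (thetaIndexOfInitial D).lstar) (x : (thetaIndexOfInitial D).Fibre (Val.non u)),
      u ∉ Sθ → ‖tOfIdeleData D r u i x‖ = 1)
    (Sq : Finset (FinitePlace ℚ))
    (htq1 : ∀ (u : FinitePlace ℚ) (x : (thetaIndexOfInitial D).Fibre (Val.non u)), u ∉ Sq →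
      ‖tqM D (ratChar u) u (natCast_ratChar_mem u) r x‖ = 1) :
    (settingPrVolSharpM D hlog (tOfIdeleData D r) (fun u x => tqM D (ratChar u) u (natCast_ratChar_mem u) r x) M archPk
        archSub Ψ act Mmod region n lat sig split qData (fun u x => tqM_ne_zero D (ratChar u) u (natCast_ratChar_mem u) r x)
        Sq htq1).Statement ↔
      ((-absLogq D -
          processionNormalized (fun i : Fin (thetaIndexOfInitial D).lstar => ∑ u ∈ Sθ,
            (((settingPrVolSharpM D hlog (tOfIdeleData D r) (fun u x => tqM D (ratChar u) u (natCast_ratChar_mem u) r x)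
                M archPk archSub Ψ act Mmod region n lat sig split qData
                (fun u x => tqM_ne_zero D (ratChar u) u (natCast_ratChar_mem u) r x) Sq htq1).thetaLocal
                (Setting.labelSucc i) (Val.non u)).untopD 0 -
              ((settingPrVolSharpM D hlog (fun _ _ _ => 1) (fun _ _ => 1) M archPk archSub Ψ act Mmod region n lat sig
                split qData (fun _ _ => one_ne_zero) ∅ (fun _ _ _ => norm_one)).thetaLocal (Setting.labelSucc i)
                  (Val.non u)).untopD 0)) : ℝ) : WithTop ℝ) ≤
        (settingPrVolSharpM D hlog (fun _ _ _ => 1) (fun _ _ => 1) M archPk archSub Ψ act Mmod region n lat sig split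
          qData (fun _ _ => one_ne_zero) ∅ (fun _ _ _ => norm_one)).negLogTheta := by
  rw [statement_settingPrVolSharpM_iff_general D hlog M archPk archSub Ψ act Mmod region n lat sig split qData
    (tOfIdeleData D r) (fun u x => tqM D (ratChar u) u (natCast_ratChar_mem u) r x) (tOfIdeleData_ne_zero D r) Sθ hSθ
    (fun u x => tqM_ne_zero D (ratChar u) u (natCast_ratChar_mem u) r x) Sq htq1,
    negLogQ_settingPrVolSharpM_tqM_eq_neg_absLogq D hlog M archPk archSub Ψ act Mmod region n lat sig split qData
      (tOfIdeleData D r) r Sq htq1]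

/-- **The same readout with the bad set named by residue characteristics**: `S_Θ` any finite set of rational places
containing every `u` whose residue characteristic is that of a bad place of the pilot data of `D` (off such `u` the
Θ-ideles of `r` are units, abc-iut-w5-d033 / `norm_tOfIdeleData_eq_one_of_not_mem`). [cite: DupuyHilado2025, §3.3, §3.9]
[claim: Mochizuki2012, status: disputed] -/
theorem statement_settingPrVolSharpM_genuine_iff_of_image (Sθ : Finset (FinitePlace ℚ))
    (hSθ : ∀ u : FinitePlace ℚ, ratChar u ∈ (ThetaData.pilotData D).S.image (residueChar (fieldOfModuli E)) → u ∈ Sθ)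
    (Sq : Finset (FinitePlace ℚ))
    (htq1 : ∀ (u : FinitePlace ℚ) (x : (thetaIndexOfInitial D).Fibre (Val.non u)), u ∉ Sq →
      ‖tqM D (ratChar u) u (natCast_ratChar_mem u) r x‖ = 1) :
    (settingPrVolSharpM D hlog (tOfIdeleData D r) (fun u x => tqM D (ratChar u) u (natCast_ratChar_mem u) r x) M archPk
        archSub Ψ act Mmod region n lat sig split qData (fun u x => tqM_ne_zero D (ratChar u) u (natCast_ratChar_mem u) r x)
        Sq htq1).Statement ↔
      ((-absLogq D -
          processionNormalized (fun i : Fin (thetaIndexOfInitial D).lstar => ∑ u ∈ Sθ,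
            (((settingPrVolSharpM D hlog (tOfIdeleData D r) (fun u x => tqM D (ratChar u) u (natCast_ratChar_mem u) r x)
                M archPk archSub Ψ act Mmod region n lat sig split qData
                (fun u x => tqM_ne_zero D (ratChar u) u (natCast_ratChar_mem u) r x) Sq htq1).thetaLocal
                (Setting.labelSucc i) (Val.non u)).untopD 0 -
              ((settingPrVolSharpM D hlog (fun _ _ _ => 1) (fun _ _ => 1) M archPk archSub Ψ act Mmod region n lat sig
                split qData (fun _ _ => one_ne_zero) ∅ (fun _ _ _ => norm_one)).thetaLocal (Setting.labelSucc i)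
                  (Val.non u)).untopD 0)) : ℝ) : WithTop ℝ) ≤
        (settingPrVolSharpM D hlog (fun _ _ _ => 1) (fun _ _ => 1) M archPk archSub Ψ act Mmod region n lat sig split
          qData (fun _ _ => one_ne_zero) ∅ (fun _ _ _ => norm_one)).negLogTheta :=
  statement_settingPrVolSharpM_genuine_iff D hlog M archPk archSub Ψ act Mmod region n lat sig split qData r Sθ
    (fun u i x hu => norm_tOfIdeleData_eq_one_of_not_mem D r u (fun h => hu (hSθ u h)) i x) Sq htq1

end Summit.ABC.IUTFork.Thm311.Real

end
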